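import Summits.AtomisticToContinuum.BoseEinsteinCondensation.Theorems.BECCutLineWeakDisorderAcrossCutTwoSided
import HarnessLib

/-!
# Crux `TwoReplicaTransienceBound` (stmt-AtomisticToContinuum-9687), line `across-cut-thinning` v2:
# the pathwise FOUR-POINT inequality from the tilt device (`stub_fourPointOfTilt`)

Support file (`--supports stmt-AtomisticToContinuum-9687`, lead c6; first half of the registered stub
`stub_blockOfCovariance : TiltFTC → BlockOfCovarianceReduction`). For a BOUNDED measurable pair
potential `v ≤ C`, a half-length `T ≥ 0`, a constant `κ₀ ≥ 0`, two junctions `x, x'` and two frozen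
tagged paths `ω₀, ω₀'`: IF the across-cut tilted dose covariance is `≤ κ₀` at every tilt
`(s,t) ∈ [0,1]²` (multiplicative form on `crossTilt`), THEN

  `Λ(1,1) · Λ(0,0) ≤ e^{κ₀} · Λ(1,0) · Λ(0,1)`, i.e.
  `crossFull · bathTwo ≤ e^{κ₀} · crossHalf(x,ω₀) · crossHalf(x',ω₀')`.

Proof: by the realisation `stub_tiltRealisation` (`…AcrossCutTwoSided.lean`) the hypothesis is the
real covariance hypothesis of the abstract device `TiltFTC` (`…AcrossCutTiltFTC.lean`, proved) for the
bounded doses on the finite two-sided bath space; its conclusion, read back in `[0,∞]`, is the claim at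
the corners `crossTilt 1 1 0 0 = crossFull`, `crossTilt 1 0 0 0 = crossHalf x ω₀`,
`crossTilt 0 1 0 0 = crossHalf x' ω₀'`, `crossTilt 0 0 0 0 = bathTwo`.
-/

noncomputable section

open MeasureTheory Filter Set Finset
open scoped ENNReal NNReal Topology BigOperators

namespace Summit.AtomisticToContinuum.BoseEinsteinCondensation.Cruxes.TwoReplicaTransienceBound.AcrossCutThinning

open Literature.MathematicalPhysics.QuantumManyBody.BoseGas
open Summit.AtomisticToContinuum.BoseEinsteinCondensation.Cruxes.TwoReplicaTransienceBound.TracerDecoupling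
open FourPoint

variable {n : ℕ}

/-! ### The four-point inequality -/

namespace Goal

/-- Registered toolbox stub `stub_fourPointOfTilt` (first half of `stub_blockOfCovariance`): for
bounded measurable `v`, `T ≥ 0`, `κ₀ ≥ 0`, the tilt-uniform covariance bound at a junction/path pair
implies the pathwise four-point inequality `Λ(1,1)Λ(0,0) ≤ e^{κ₀} Λ(1,0)Λ(0,1)`. -/
abbrev stub_fourPointOfTilt : Prop :=
  TiltFTC → ∀ (n : ℕ) (v : ℝ → ℝ≥0∞), Measurable v → (∃ C : ℝ≥0, ∀ r, v r ≤ C) →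
    ∀ (L T : ℝ), 0 ≤ T → ∀ κ₀ : ℝ, 0 ≤ κ₀ →
    ∀ (x x' : Space) (ω₀ ω₀' : Fin 3 → (ℝ≥0 → ℝ)),
    (∀ (s t : ℝ≥0), s ≤ 1 → t ≤ 1 →
      crossTilt (n := n) s t 1 1 v L T x ω₀ x' ω₀' * crossTilt (n := n) s t 0 0 v L T x ω₀ x' ω₀' ≤
        crossTilt (n := n) s t 1 0 v L T x ω₀ x' ω₀' * crossTilt (n := n) s t 0 1 v L T x ω₀ x' ω₀' +
          ENNReal.ofReal κ₀ * crossTilt (n := n) s t 0 0 v L T x ω₀ x' ω₀' ^ 2) →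
    crossFull (n := n) v L T x ω₀ x' ω₀' * bathTwo v L T n ≤
      ENNReal.ofReal (Real.exp κ₀) * (crossHalf (n := n) v L T x ω₀ * crossHalf (n := n) v L T x' ω₀')

end Goal

/-- **The pathwise four-point inequality from the tilt device** (toolbox stub
`stub_fourPointOfTilt`, see the module docstring). -/
theorem stub_fourPointOfTilt : Goal.stub_fourPointOfTilt := by
  intro hFTC n v hv hbdd L T hT κ₀ hκ₀ x x' ω₀ ω₀' hC
  obtain ⟨C, hCv⟩ := hbdd
  set μ := twoSidedMeasure v L T n with hμdef
  set A := doseA (n := n) v T x ω₀ with hAdef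
  set A' := doseA' (n := n) v T x' ω₀' with hA'def
  -- shorthand for the realisation identity
  have hR : ∀ {s t : ℝ}, 0 ≤ s → 0 ≤ t → ∀ i j : ℕ,
      crossTilt (n := n) s.toNNReal t.toNNReal i j v L T x ω₀ x' ω₀' ≠ ⊤ ∧
      tiltLaplace μ A A' s t i j =
        (crossTilt (n := n) s.toNNReal t.toNNReal i j v L T x ω₀ x' ω₀').toReal :=
    fun hs ht i j => tiltLaplace_eq_crossTilt hv hCv L hT x ω₀ x' ω₀' hs ht i j
  -- finiteness of the measure
  have hμfin : ∫⁻ q, twoSidedDensity v L T n q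
      ∂(volume : Measure (Config n)).prod ((wienerPaths n).prod (wienerPaths n)) ≠ ⊤ := by
    rw [lintegral_twoSidedDensity hv L T n]
    exact bathTwo_ne_top v L hT n
  haveI : IsFiniteMeasure μ := by
    rw [hμdef, twoSidedMeasure]
    exact isFiniteMeasure_withDensity hμfin
  -- bounds on the doses
  set D : ℝ := (n : ℝ) * C * T with hDdef
  have hAle : ∀ q, A q ≤ D ∧ A' q ≤ D := fun q => by
    have h1 := taggedBathAction_le (n := n) hCv T x q.1 ω₀ q.2.1
    have h2 := taggedBathAction_le (n := n) hCv T x' q.1 ω₀' q.2.2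
    have hne : (n : ℝ≥0∞) * C * ENNReal.ofReal T ≠ ⊤ := ENNReal.mul_ne_top (ENNReal.mul_ne_top
      (ENNReal.natCast_ne_top n) ENNReal.coe_ne_top) ENNReal.ofReal_ne_top
    have h1' := ENNReal.toReal_mono hne h1
    have h2' := ENNReal.toReal_mono hne h2
    simp only [ENNReal.toReal_mul, ENNReal.toReal_natCast, ENNReal.coe_toReal,
      ENNReal.toReal_ofReal hT] at h1' h2'
    exact ⟨h1', h2'⟩
  -- the covariance hypothesis, read in the reals
  have hcov : ∀ s t : ℝ, 0 ≤ s → s ≤ 1 → 0 ≤ t → t ≤ 1 →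
      tiltLaplace μ A A' s t 1 1 * tiltLaplace μ A A' s t 0 0 ≤
        tiltLaplace μ A A' s t 1 0 * tiltLaplace μ A A' s t 0 1 +
          κ₀ * tiltLaplace μ A A' s t 0 0 ^ 2 := by
    intro s t hs hs1 ht ht1
    obtain ⟨h11t, h11⟩ := hR hs ht 1 1
    obtain ⟨h00t, h00⟩ := hR hs ht 0 0
    obtain ⟨h10t, h10⟩ := hR hs ht 1 0
    obtain ⟨h01t, h01⟩ := hR hs ht 0 1
    have hs' : s.toNNReal ≤ 1 := Real.toNNReal_le_one.2 hs1
    have ht' : t.toNNReal ≤ 1 := Real.toNNReal_le_one.2 ht1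
    have h := hC s.toNNReal t.toNNReal hs' ht'
    have hrhs : crossTilt (n := n) s.toNNReal t.toNNReal 1 0 v L T x ω₀ x' ω₀' *
          crossTilt (n := n) s.toNNReal t.toNNReal 0 1 v L T x ω₀ x' ω₀' +
        ENNReal.ofReal κ₀ * crossTilt (n := n) s.toNNReal t.toNNReal 0 0 v L T x ω₀ x' ω₀' ^ 2 ≠ ⊤ :=
      ENNReal.add_ne_top.2 ⟨ENNReal.mul_ne_top h10t h01t,
        ENNReal.mul_ne_top ENNReal.ofReal_ne_top (ENNReal.pow_ne_top h00t)⟩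
    have h' := (ENNReal.toReal_le_toReal (ENNReal.mul_ne_top h11t h00t) hrhs).2 h
    rw [ENNReal.toReal_mul, ENNReal.toReal_add (ENNReal.mul_ne_top h10t h01t)
        (ENNReal.mul_ne_top ENNReal.ofReal_ne_top (ENNReal.pow_ne_top h00t)),
      ENNReal.toReal_mul, ENNReal.toReal_mul, ENNReal.toReal_pow, ENNReal.toReal_ofReal hκ₀] at h'
    rw [h11, h00, h10, h01]
    exact h'
  -- the abstract device
  have hdev := hFTC (Config n × (PathSpace n × PathSpace n)) μ A A'
    (measurable_doseA hv T x ω₀) (measurable_doseA' hv T x' ω₀')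
    (fun q => ENNReal.toReal_nonneg) (fun q => ENNReal.toReal_nonneg) ⟨D, hAle⟩ κ₀ hκ₀ hcov
  -- convert the conclusion back to `[0,∞]`
  obtain ⟨h11t, h11⟩ := hR zero_le_one zero_le_one 0 0
  obtain ⟨h00t, h00⟩ := hR le_rfl le_rfl 0 0
  obtain ⟨h10t, h10⟩ := hR zero_le_one le_rfl 0 0
  obtain ⟨h01t, h01⟩ := hR le_rfl zero_le_one 0 0
  simp only [Real.toNNReal_one, Real.toNNReal_zero] at h11 h00 h10 h01 h11t h00t h10t h01t
  rw [h11, h00, h10, h01, ← ENNReal.toReal_mul, ← ENNReal.toReal_mul,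
    ← ENNReal.toReal_ofReal (Real.exp_pos κ₀).le, ← ENNReal.toReal_mul] at hdev
  have hlhs : crossTilt (n := n) 1 1 0 0 v L T x ω₀ x' ω₀' *
      crossTilt (n := n) 0 0 0 0 v L T x ω₀ x' ω₀' ≠ ⊤ := ENNReal.mul_ne_top h11t h00t
  have hrhs : ENNReal.ofReal (Real.exp κ₀) *
      (crossTilt (n := n) 1 0 0 0 v L T x ω₀ x' ω₀' * crossTilt (n := n) 0 1 0 0 v L T x ω₀ x' ω₀') ≠ ⊤ :=
    ENNReal.mul_ne_top ENNReal.ofReal_ne_top (ENNReal.mul_ne_top h10t h01t)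
  have h := (ENNReal.toReal_le_toReal hlhs hrhs).1 hdev
  rw [crossTilt_one_one, stub_crossTiltCorner, crossTilt_one_zero, crossTilt_zero_one] at h
  exact h

end Summit.AtomisticToContinuum.BoseEinsteinCondensation.Cruxes.TwoReplicaTransienceBound.AcrossCutThinning

end
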